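import Summits.AtomisticToContinuum.BoseEinsteinCondensation.Theses.BECStronglyRayleigh
import Summits.AtomisticToContinuum.BoseEinsteinCondensation.Theorems.InsertionFieldDelocalisation.Negative.PerronExistence
import Literature.MathematicalPhysics.QuantumLattice.LiebMattisSectorPF
import Literature.MathematicalPhysics.QuantumLattice.SpinChainsAkltCorrelationProofs
import HarnessLib

/-!
# The ground state of the penalised XY Hamiltonian (helper for `LatticeCoherenceAssembly`,
# item stmt-AtomisticToContinuum-9680, route BECStronglyRayleigh)

For `1 ≤ d`, `2 ≤ L`, `N ≤ L^d`, the supports `SectorGroundStatePerron` (a nonnegative sector ground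
vector `ψ` of `xyTorus d L 1` in the sector `S³_tot = N - L^d/2`, unique up to scalars) and
`PenaltySelectsSector` (ground vectors of the penalised Hamiltonian
`xyTorus d L 1 + (d+1)L^d · (S³_tot + (L^d/2 - N))²` are annihilated by the penalty) identify the
ground space of the penalised Hamiltonian with `ℂψ`; hence its tracial ground-state functional is the
vector state of `ψ` (`groundStateFunctional_eq_of_hasUniqueGroundState`).
-/

noncomputable section

namespace Summit.AtomisticToContinuum.BoseEinsteinCondensation.Theorems.LatticeCoherence

open scoped BigOperators Matrix ComplexOrder
open Literature.MathematicalPhysics.QuantumLattice Literature.Probability.LatticeModels Matrix Finset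
  Complex
open Summit.AtomisticToContinuum.BoseEinsteinCondensation.Theses.BECStronglyRayleigh
open Summit.AtomisticToContinuum.BoseEinsteinCondensation.Theorems.InsertionFieldDelocalisation.Negative

section Penalty

variable (d L : ℕ) [NeZero L] (N : ℕ)

/-- The penalty `S³_tot + (L^d/2 - N)·1` annihilates exactly the magnetisation sector
`S³_tot = N - L^d/2`. [folklore] -/
theorem penalty_mulVec_eq_zero_iff (φ : TensorIndex (TorusSite d L) 2 → ℂ) :
    (totalSpin (Λ := TorusSite d L) 1 2 + ((L : ℂ) ^ d / 2 - (N : ℂ)) • 1) *ᵥ φ = 0 ↔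
      φ ∈ spinZSector 1 ((N : ℝ) - (L : ℝ) ^ d / 2) := by
  rw [spinZSector, Module.End.mem_eigenspace_iff, Matrix.toLin'_apply, add_mulVec, smul_mulVec,
    one_mulVec, add_eq_zero_iff_eq_neg, ← neg_smul]
  have hM : (((N : ℝ) - (L : ℝ) ^ d / 2 : ℝ) : ℂ) = -((L : ℂ) ^ d / 2 - (N : ℂ)) := by
    push_cast
    ring
  rw [hM]

/-- The sector `S³_tot = N - L^d/2` of spin `½` on `(ℤ/Lℤ)^d` is the coordinate subspace of the
configurations of weight `L^d - N` (`N` up spins). [folklore] -/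
theorem mem_sector_iff_weight (hN : N ≤ L ^ d) (φ : TensorIndex (TorusSite d L) 2 → ℂ) :
    φ ∈ spinZSector 1 ((N : ℝ) - (L : ℝ) ^ d / 2) ↔ ∀ σ, (∑ x, (σ x : ℕ)) ≠ L ^ d - N → φ σ = 0 := by
  have hM : ((N : ℝ) - (L : ℝ) ^ d / 2) =
      (((Fintype.card (TorusSite d L) * 1 : ℕ) : ℝ) / 2 - ((L ^ d - N : ℕ) : ℝ)) := by
    rw [InsertionFieldDelocalisation.Negative.card_torusSite, Nat.cast_sub hN]
    push_cast
    ring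
  rw [hM]
  exact LiebMattis.mem_spinZSector_weight_iff 1 (L ^ d - N) φ

/-- The sector energy `E_min(N - L^d/2)` of `xyTorus d L 1` bounds the Rayleigh quotient of unit
sector vectors from below (`sector_groundState` on the weight-`(L^d - N)` coordinate sector, which
the weight-preserving `xyTorus` leaves invariant). [folklore] -/
theorem sectorEnergy_le_rayleigh (hN : N ≤ L ^ d) (v : TensorIndex (TorusSite d L) 2 → ℂ)
    (hv : v ∈ spinZSector 1 ((N : ℝ) - (L : ℝ) ^ d / 2)) (hv1 : star v ⬝ᵥ v = 1) :
    lowestEnergyInSector 1 (xyTorus d L 1) ((N : ℝ) - (L : ℝ) ^ d / 2) ≤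
      (star v ⬝ᵥ xyTorus d L 1 *ᵥ v).re := by
  have hcard := InsertionFieldDelocalisation.Negative.card_torusSite d L
  obtain ⟨S, -, hS⟩ : ∃ S ⊆ (Finset.univ : Finset (TorusSite d L)), S.card = N :=
    Finset.exists_subset_card_eq (by rw [Finset.card_univ, hcard]; exact hN)
  have hW : ∃ σ : TensorIndex (TorusSite d L) 2, (∑ z, (σ z : ℕ)) = L ^ d - N :=
    ⟨fun z => if z ∈ S then 0 else 1, by rw [weight_ind S, Finset.card_compl, hS, hcard]⟩
  obtain ⟨-, h2⟩ := sector_groundState (xyTorus d L 1) (xxzZero_isHermitian _ _)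
    (fun σ => (∑ z, (σ z : ℕ)) = L ^ d - N) hW
    (fun σ τ hσ hτ => xxzZero_apply_eq_zero_of_weight_ne _ _ (by rw [hτ]; exact hσ))
    (spinZSector 1 ((N : ℝ) - (L : ℝ) ^ d / 2)) (mem_sector_iff_weight d L N hN)
  exact h2 v hv hv1

/-- The penalised Hamiltonian `xyTorus d L 1 + (d+1)L^d · (S³_tot + (L^d/2 - N))²` is Hermitian.
[folklore] -/
theorem penalised_isHermitian :
    (xyTorus d L 1 + (((d + 1) * L ^ d : ℕ) : ℂ) •
      (totalSpin 1 2 + ((L : ℂ) ^ d / 2 - (N : ℂ)) • 1) ^ 2).IsHermitian := by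
  have hsa : IsSelfAdjoint ((L : ℂ) ^ d / 2 - (N : ℂ)) := by
    have h : ((L : ℂ) ^ d / 2 - (N : ℂ)) = (((L : ℝ) ^ d / 2 - (N : ℝ) : ℝ) : ℂ) := by push_cast; ring
    rw [isSelfAdjoint_iff, h, Complex.star_def, Complex.conj_ofReal]
  have hk : IsSelfAdjoint ((((d + 1) * L ^ d : ℕ) : ℂ)) := by
    rw [isSelfAdjoint_iff, Complex.star_def, map_natCast]
  have hPen : (totalSpin (Λ := TorusSite d L) 1 2 + ((L : ℂ) ^ d / 2 - (N : ℂ)) • 1).IsHermitian :=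
    (totalSpin_isHermitian 1 2).add (isHermitian_one.smul hsa)
  exact (xxzZero_isHermitian _ _).add ((hPen.pow 2).smul hk)

end Penalty

/-- **The penalised ground state is the Perron vector of the sector.** Under
`SectorGroundStatePerron` and `PenaltySelectsSector`, for `1 ≤ d`, `2 ≤ L`, `N ≤ L^d`: the Perron
vector `ψ` of the sector `N - L^d/2` of `xyTorus d L 1` (nonzero, entrywise real-nonnegative, a sector
ground vector, unique up to scalars) spans the ground space of the penalised Hamiltonian, whose
tracial ground-state functional is therefore the vector state `O ↦ ⟨ψ, Oψ⟩/⟨ψ, ψ⟩`. Proof: ground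
vectors of the penalised `H'` lie in the sector (penalty selection), where `H' = H`; the variational
principle gives `E₀(H') = E_min(sector)`, and sector uniqueness gives `ker(H' - E₀) = ℂψ`.
[folklore] -/
theorem groundState_penalised (hP : SectorGroundStatePerron) (hPen : PenaltySelectsSector)
    (d L : ℕ) [NeZero L] (N : ℕ) (hd : 1 ≤ d) (hL : 2 ≤ L) (hN : N ≤ L ^ d) :
    ∃ ψ : TensorIndex (TorusSite d L) 2 → ℂ, ψ ≠ 0 ∧ (∀ σ, 0 ≤ (ψ σ).re ∧ (ψ σ).im = 0) ∧
      ψ ∈ spinZSector 1 ((N : ℝ) - (L : ℝ) ^ d / 2) ∧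
      (xyTorus d L 1) *ᵥ ψ =
        ((lowestEnergyInSector 1 (xyTorus d L 1) ((N : ℝ) - (L : ℝ) ^ d / 2) : ℝ) : ℂ) • ψ ∧
      (∀ ψ' : TensorIndex (TorusSite d L) 2 → ℂ, ψ' ∈ spinZSector 1 ((N : ℝ) - (L : ℝ) ^ d / 2) →
        (xyTorus d L 1) *ᵥ ψ' =
          ((lowestEnergyInSector 1 (xyTorus d L 1) ((N : ℝ) - (L : ℝ) ^ d / 2) : ℝ) : ℂ) • ψ' →
        ∃ c : ℂ, ψ' = c • ψ) ∧
      ∀ O : Op (TorusSite d L) 2,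
        (xyTorus d L 1 + (((d + 1) * L ^ d : ℕ) : ℂ) •
            (totalSpin 1 2 + ((L : ℂ) ^ d / 2 - (N : ℂ)) • 1) ^ 2).groundStateFunctional O =
          star ψ ⬝ᵥ O *ᵥ ψ / star ψ ⬝ᵥ ψ := by
  obtain ⟨ψ, hψ0, hψnn, hψsec, hHψ, huniq⟩ := hP d L hd hL N hN
  refine ⟨ψ, hψ0, hψnn, hψsec, hHψ, huniq, ?_⟩
  set H : Op (TorusSite d L) 2 := xyTorus d L 1 with hHdef
  set Pen : Op (TorusSite d L) 2 := totalSpin 1 2 + ((L : ℂ) ^ d / 2 - (N : ℂ)) • 1 with hPendef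
  set k : ℂ := (((d + 1) * L ^ d : ℕ) : ℂ) with hkdef
  set Hp : Op (TorusSite d L) 2 := H + k • Pen ^ 2 with hHpdef
  set E : ℝ := lowestEnergyInSector 1 H ((N : ℝ) - (L : ℝ) ^ d / 2) with hEdef
  have hHpherm : Hp.IsHermitian := penalised_isHermitian d L N
  -- on the kernel of the penalty the penalised Hamiltonian is `H`
  have hHp_of_pen : ∀ φ : TensorIndex (TorusSite d L) 2 → ℂ, Pen *ᵥ φ = 0 → Hp *ᵥ φ = H *ᵥ φ := by
    intro φ hφ
    rw [hHpdef, add_mulVec, smul_mulVec, pow_two, ← mulVec_mulVec, hφ, mulVec_zero, smul_zero,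
      add_zero]
  have hPenψ : Pen *ᵥ ψ = 0 := (penalty_mulVec_eq_zero_iff d L N ψ).2 hψsec
  have hHpψ : Hp *ᵥ ψ = (E : ℂ) • ψ := by rw [hHp_of_pen ψ hPenψ, hHψ]
  -- `E₀(Hp) ≤ E` : `ψ` is a trial state
  have hle1 : Hp.groundEnergy ≤ E := by
    obtain ⟨c, -, hc1⟩ := exists_smul_unit hψ0
    have h := Matrix.groundEnergy_le_rayleigh_holds hHpherm _ hc1
    rw [mulVec_smul, hHpψ, smul_comm, dotProduct_smul, hc1, smul_eq_mul, mul_one, Complex.ofReal_re]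
      at h
    exact h
  -- a ground vector of `Hp` lies in the sector, where it is an eigenvector of `H` at `E₀(Hp)`
  obtain ⟨φ₀, hφ₀mem, hφ₀0⟩ :=
    (Submodule.ne_bot_iff _).1 (Matrix.groundSpace_ne_bot_holds hHpherm)
  have hφ₀eq : Hp *ᵥ φ₀ = (Hp.groundEnergy : ℂ) • φ₀ := (Matrix.mem_groundSpace_iff Hp φ₀).1 hφ₀mem
  have hPenφ₀ : Pen *ᵥ φ₀ = 0 := hPen d L N hd hN φ₀ hφ₀mem
  have hφ₀sec : φ₀ ∈ spinZSector 1 ((N : ℝ) - (L : ℝ) ^ d / 2) :=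
    (penalty_mulVec_eq_zero_iff d L N φ₀).1 hPenφ₀
  have hHφ₀ : H *ᵥ φ₀ = (Hp.groundEnergy : ℂ) • φ₀ := by rw [← hHp_of_pen φ₀ hPenφ₀, hφ₀eq]
  -- `E ≤ E₀(Hp)` : the sector energy bounds the Rayleigh quotient of `φ₀`
  have hle2 : E ≤ Hp.groundEnergy := by
    obtain ⟨c, -, hc1⟩ := exists_smul_unit hφ₀0
    have h := sectorEnergy_le_rayleigh d L N hN (c • φ₀) (Submodule.smul_mem _ c hφ₀sec) hc1
    rw [mulVec_smul, hHφ₀, smul_comm, dotProduct_smul, hc1, smul_eq_mul, mul_one, Complex.ofReal_re]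
      at h
    exact h
  have hE : Hp.groundEnergy = E := le_antisymm hle1 hle2
  -- the ground space is the line `ℂψ`
  have hψmem : ψ ∈ Hp.groundSpace := by rw [Matrix.mem_groundSpace_iff, hHpψ, hE]
  have hspan : Hp.groundSpace = ℂ ∙ ψ := by
    refine le_antisymm ?_ ?_
    · intro φ hφ
      have hφeq : Hp *ᵥ φ = (Hp.groundEnergy : ℂ) • φ := (Matrix.mem_groundSpace_iff Hp φ).1 hφ
      have hPenφ : Pen *ᵥ φ = 0 := hPen d L N hd hN φ hφ
      have hφsec : φ ∈ spinZSector 1 ((N : ℝ) - (L : ℝ) ^ d / 2) :=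
        (penalty_mulVec_eq_zero_iff d L N φ).1 hPenφ
      have hHφ : H *ᵥ φ = (E : ℂ) • φ := by rw [← hHp_of_pen φ hPenφ, hφeq, hE]
      obtain ⟨c, hc⟩ := huniq φ hφsec hHφ
      rw [Submodule.mem_span_singleton]
      exact ⟨c, hc.symm⟩
    · rw [Submodule.span_le, Set.singleton_subset_iff]
      exact hψmem
  have huniqGS : Hp.HasUniqueGroundState := by
    show Module.finrank ℂ Hp.groundSpace = 1
    rw [hspan]
    exact finrank_span_singleton hψ0
  intro O
  exact groundStateFunctional_eq_of_hasUniqueGroundState huniqGS hψmem hψ0 O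

end Summit.AtomisticToContinuum.BoseEinsteinCondensation.Theorems.LatticeCoherence
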